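import Summits.Ventures.HodgeRepro2.T6B4Main

/-!
# T6B4Count — the counting form of Prop. B4.3(2): the `F`-type of `A_μ ⊗_{τ₁} ℂ` is `r · Φ_μ⁻¹`
(Tier 6, sub-goal B4; cell pub-hodge-repro2; owner t6-p7, route/T6-B4-t6-p7.md)

TIER4 Prop. B4.3(2) ends with «Lie(A_μ ⊗_{τ₁} ℂ) ≅ ⊕_{σ ∈ Φ_μ⁻¹} ℂ_σ^{⊕ r} as an F-module,
r = [M̃_μ : F₁]». `B4_main` gives the set-theoretic form (`Φ̃(τ₁) = inducedSet (Φ_μ⁻¹)`); here the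
numbers: `ncard_inducedSet` (the type induced from `(K, T)` has `|T| · [M : K]` elements — the fibres
above `σ ∈ T` are disjoint, `disjoint_fibre`, and each has `[M : K]` elements, `card_fibre` /
`fibreEquivAlgHom` of p1's InducedTypeSplitting / InducedTypeAssembly) and `ncard_eq`
(`|Φ̃(τ₁)| = |Φ_μ⁻¹| · [M̃_μ : F₁]` under (Eq), (D), `F₁ ⊆ M̃_μ`).
Proof lane: 0 sorry; axioms ⊆ {propext, Classical.choice, Quot.sound}.
§8(d): uses an L-value-free non-vanishing device: NO.
-/

namespace Summit.Ventures.HodgeRepro2.T6.B4Count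

open Summit.Ventures.HodgeRepro2 Summit.Ventures.HodgeRepro2.T6.B4Interface
  Summit.Ventures.HodgeRepro2.T6.B4Main

variable {K : Type*} [Field K] [NumberField K]

/-! ### The counting form of Prop. B4.3(2): «r · Φ_μ⁻¹», r = [M̃_μ : F₁] -/

omit [NumberField K] in
/-- The CM type induced from `(K, T)` has `|T| · [M : K]` elements: the fibres above the `σ ∈ T`
are disjoint (`disjoint_fibre`) and each has `[M : K]` elements (`card_fibre`, `fibreEquivAlgHom`). -/
theorem ncard_inducedSet (M : IntermediateField ℚ ℂ) [Algebra K M] [FiniteDimensional K M]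
    [Algebra.IsSeparable K M] (T : Set (K →+* ℂ)) (hT : T.Finite) :
    (inducedSet (K := K) (L := M) T).ncard = T.ncard * Module.finrank K M := by
  classical
  have hfin : ∀ σ : K →+* ℂ, (fibre (K := K) (L := M) σ).Finite := fun σ => by
    letI := σ.toAlgebra
    haveI : Finite (ExtHom M σ) := inferInstance
    exact Set.finite_coe_iff.1 (Finite.of_equiv _ (fibreEquivAlgHom σ).symm)
  have hcard : ∀ σ : K →+* ℂ, (fibre (K := K) (L := M) σ).ncard = Module.finrank K M := fun σ => by
    letI := σ.toAlgebra
    rw [← Nat.card_coe_set_eq, Nat.card_congr (fibreEquivAlgHom σ), Nat.card_eq_fintype_card]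
    exact card_fibre
  rw [inducedSet_eq_iUnion,
    Set.Finite.ncard_biUnion hT (fun σ _ => hfin σ) (fun _ _ _ _ hne => disjoint_fibre hne),
    finsum_mem_eq_finite_toFinset_sum _ hT]
  simp only [hcard, Finset.sum_const, smul_eq_mul, Set.ncard_eq_toFinset_card T hT]

/-- **The `F`-type of `A_μ ⊗_{τ₁} ℂ` is `r · Φ_μ⁻¹` in numbers**: under (Eq), (D) and `F₁ ⊆ M̃_μ`,
`|Φ̃(τ₁)| = |Φ_μ⁻¹| · [M̃_μ : F₁]` (`B4_main` + `ncard_inducedSet`). -/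
theorem ncard_eq [IsGalois ℚ K] (τ₁ : K →+* ℂ) (Φμ : Set (K →+* ℂ))
    (M : IntermediateField ℚ ℂ) [FiniteDimensional ℚ M] [Algebra K M] [FiniteDimensional K M]
    [Algebra.IsSeparable K M] (hτ : (algebraMap M ℂ).comp (algebraMap K M) = τ₁)
    (Φt : (K →+* ℂ) → Set (M →+* ℂ)) (hEq : EqCompat M Φt) (hD : HodgeDictionary M Φμ Φt) :
    (Φt τ₁).ncard = (inverseType K τ₁ Φμ).ncard * Module.finrank K M := by
  have h := B4_main τ₁ Φμ M hτ Φt hEq hD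
  unfold InverseTypeForced at h
  rw [h, ncard_inducedSet M _ (Set.toFinite _)]

end Summit.Ventures.HodgeRepro2.T6.B4Count
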